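import Summits.Ventures.HodgeRepro2.T5SU11CoeffSqCartan
import Summits.Ventures.HodgeRepro2.T5BergmanPairing

/-!
# `∫_G (1 - |g·0|²)^k dν = π / (k - 1)` for every weight `k ≥ 2`: the disc and the Cartan computations

For `k ≥ 2` the function `coeffPow k g = (1 - |g·0|²)^k` (`cosh(η/2)^{-2k}` in Cartan coordinates; the
square of the normalised weight-`k` lowest-weight coefficient, `T5BergmanCoefficient`) is
integrable against every Haar measure of `SU(1,1)` (`integrable_coeffPow`: through the fibration,
its `poincare`-density is `(1 - |z|²)^{k-2}`, bounded on the disc), and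
**`∫_G coeffPow k dν = π / (k - 1)`** (`integral_coeffPow_nu`; `c • ∫_G coeffPow k dμ = π/(k-1)` for
every Haar `μ`, `integral_coeffPow`) — computed through the disc with
`T5BergmanPairing.pairing_lowest_lowest` (`∫_𝔻 (1 - |z|²)^{k-2} dA = π/(k-1)`). The same value is
obtained through the SPHERICAL formula: `coeffPow k` is bi-`K`-invariant, equals `cosh^{-2k} t` on
`a_t`, and `2π ∫_0^∞ sinh t · cosh^{-(2k-1)} t dt = π/(k-1)` by `T5SU11CoeffSqCartan`'s
`integral_sinh_mul_inv_cosh_pow` (`integral_coeffPow_nu_cartan`, `integral_coeffPow_nu_cartan'`). The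
two computations agree for every weight (`cartan_eq_disc_pow`), generalising the weight-3 case of
`T5SU11CoeffSqCartan`. Nothing is claimed about (N).

Blind lane: Mathlib + the HodgeRepro2 prefix only; no sorry; axioms ⊆ {propext, Classical.choice,
Quot.sound}.
-/

namespace Summit.Ventures.HodgeRepro2.T5SU11CoeffPowCartan

open MeasureTheory MeasureTheory.Measure Metric Set Filter Topology Complex
open T5PoincareDensity T5PoincareMeasure T5SU11Unimodular T5SU11Fibration T5SU11FibrationHaar
  T5SU11FibrationCartan T5HaarCircle T5SU11Cartan T5SU11OneParameter T5BergmanCoefficient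
  T5SU11CoefficientL2 T5SU11SphericalIntegral T5SU11CoeffSqCartan T5BergmanPairing
open scoped ENNReal NNReal Real

/-! ### `coeffPow k g = (1 - |g·0|²)^k` -/

/-- `coeffPow k g = (1 - |g·0|²)^k`, the `k`-th power of `1 - |g·0|² = cosh(η/2)^{-2}`. -/
noncomputable def coeffPow (k : ℕ) (g : SU11) : ℝ := (1 - ‖orbit g‖ ^ 2) ^ k

/-- `coeffPow` is continuous. -/
lemma continuous_coeffPow (k : ℕ) : Continuous (coeffPow k) :=
  ((continuous_const.sub (continuous_orbit.norm.pow 2)).pow k)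

/-- `coeffPow k (Φ(z, u)) = (1 - |z|²)^k` on the disc. -/
lemma coeffPow_fib (k : ℕ) {z : ℂ} (hz : z ∈ ball (0 : ℂ) 1) (u : Circle) :
    coeffPow k (fib (z, u)) = (1 - ‖z‖ ^ 2) ^ k := by
  unfold coeffPow
  rw [orbit_fib hz u]

/-- **`coeffPow k` is bi-`K`-invariant.** -/
theorem coeffPow_rot_mul_rot (k : ℕ) (u v : Circle) (g : SU11) :
    coeffPow k (rot u * g * rot v) = coeffPow k g := by
  unfold coeffPow
  rw [mul_assoc, norm_orbit_rot_mul, orbit_mul_rot]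

/-- **`coeffPow k (a_t) = cosh^{-2k} t`.** -/
theorem coeffPow_hyp (k : ℕ) (t : ℝ) : coeffPow k (hyp t) = (Real.cosh t)⁻¹ ^ (2 * k) := by
  unfold coeffPow
  rw [orbit_hyp, Complex.norm_real, Real.norm_eq_abs, sq_abs, one_sub_tanh_sq, ← pow_mul]

/-- The disc integrand: `(1 - |z|²)⁻² · (1 - |z|²)^{m+2} = (1 - |z|²)^m`. -/
lemma dens_mul_pow {z : ℂ} (hz : z ∈ ball (0 : ℂ) 1) (m : ℕ) :
    dens z * (1 - ‖z‖ ^ 2) ^ (m + 2) = (1 - ‖z‖ ^ 2) ^ m := by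
  rw [dens_eq_norm]
  have h : 1 - ‖z‖ ^ 2 ≠ 0 := by
    have := mem_ball_zero_iff.mp hz
    have h2 : ‖z‖ ^ 2 < 1 := by nlinarith [norm_nonneg z]
    linarith
  field_simp
  ring

/-- `(1 - |z|²)^{m+2}` is `poincare`-integrable (its density integrand `(1 - |z|²)^m` is bounded
and continuous on the closed disc). -/
lemma integrable_pow_poincare (m : ℕ) :
    Integrable (fun z : ℂ => (1 - ‖z‖ ^ 2) ^ (m + 2)) poincare := by
  have hd : Measurable fun z : ℂ => Real.toNNReal (dens z) := measurable_dens.real_toNNReal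
  have e : poincare = (volume.restrict (ball 0 1)).withDensity
      fun z => ((Real.toNNReal (dens z) : ℝ≥0) : ℝ≥0∞) := rfl
  rw [e, integrable_withDensity_iff_integrable_smul hd]
  have hcont : Continuous fun z : ℂ => (1 - ‖z‖ ^ 2) ^ m := by fun_prop
  have hint : IntegrableOn (fun z : ℂ => (1 - ‖z‖ ^ 2) ^ m) (ball 0 1) :=
    (hcont.continuousOn.integrableOn_compact (isCompact_closedBall (0 : ℂ) 1)).mono_set
      ball_subset_closedBall
  refine hint.congr_fun ?_ measurableSet_ball
  intro z hz
  simp only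
  rw [NNReal.smul_def, Real.coe_toNNReal _ (dens_nonneg z), smul_eq_mul, dens_mul_pow hz]

/-- **`∫_𝔻 (1 - |z|²)^m dA = π / (m + 1)`** (the real form of `T5BergmanPairing.pairing_lowest_lowest`). -/
theorem integral_ball_one_sub_norm_sq_pow (m : ℕ) :
    ∫ z in ball (0 : ℂ) 1, (1 - ‖z‖ ^ 2) ^ m = π / ((m : ℝ) + 1) := by
  have h := pairing_lowest_lowest (m + 2) (by omega)
  unfold pairing at h
  simp only [lowest, map_one, mul_one, one_mul, show m + 2 - 2 = m by omega] at h
  rw [integral_complex_ofReal] at h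
  have h' : (∫ z in ball (0 : ℂ) 1, (1 - ‖z‖ ^ 2) ^ m) = π / (((m + 2 : ℕ) : ℝ) - 1) :=
    Complex.ofReal_injective h
  rw [h']
  push_cast
  ring_nf

section measure

variable [MeasurableSpace Circle] [BorelSpace Circle]

/-- **`coeffPow k` is integrable against every Haar measure of `SU(1,1)`** for `k ≥ 2`. -/
theorem integrable_coeffPow (μ : Measure SU11) [IsHaarMeasure μ] {k : ℕ} (hk : 2 ≤ k) :
    Integrable (coeffPow k) μ := by
  obtain ⟨m, rfl⟩ := Nat.exists_eq_add_of_le' hk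
  set c := haarScalarFactor (nu haarCircle) μ with hc
  have hc0 : c ≠ 0 := (haarScalarFactor_cartan_pos μ).ne'
  have hnu : nu haarCircle = c • μ := nu_eq_smul haarCircle μ
  have hmeas : AEStronglyMeasurable (coeffPow (m + 2)) (nu haarCircle) :=
    (continuous_coeffPow _).aestronglyMeasurable
  have hint_nu : Integrable (coeffPow (m + 2)) (nu haarCircle) := by
    rw [nu, integrable_map_measure (by rw [← nu]; exact hmeas) measurable_fib.aemeasurable]
    have hae : (fun p : ℂ × Circle => (1 - ‖p.1‖ ^ 2) ^ (m + 2)) =ᵐ[poincare.prod haarCircle]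
        (coeffPow (m + 2) ∘ fib) := by
      have hnull : (poincare.prod haarCircle) ((ball (0 : ℂ) 1)ᶜ ×ˢ (Set.univ : Set Circle)) = 0 := by
        rw [Measure.prod_prod, poincare_compl_ball, zero_mul]
      rw [Filter.EventuallyEq, ae_iff]
      apply measure_mono_null _ hnull
      intro p hp
      simp only [Set.mem_setOf_eq] at hp
      refine ⟨?_, Set.mem_univ _⟩
      intro hball
      exact hp (by rw [Function.comp_apply, show fib p = fib (p.1, p.2) from rfl,
        coeffPow_fib _ hball])
    exact ((integrable_pow_poincare m).comp_fst haarCircle).congr hae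
  rw [hnu] at hint_nu
  exact (integrable_smul_measure (ENNReal.coe_ne_zero.mpr hc0) ENNReal.coe_ne_top).mp hint_nu

/-- **The disc computation**: `c • ∫_G (1 - |g·0|²)^k dμ = π / (k - 1)` for every Haar measure `μ`
and `k ≥ 2`, `c = haarScalarFactor (nu haarCircle) μ`. -/
theorem integral_coeffPow (μ : Measure SU11) [IsHaarMeasure μ] {k : ℕ} (hk : 2 ≤ k) :
    (haarScalarFactor (nu haarCircle) μ : ℝ) • ∫ g, coeffPow k g ∂μ = π / ((k : ℝ) - 1) := by
  obtain ⟨m, rfl⟩ := Nat.exists_eq_add_of_le' hk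
  rw [integral_eq haarCircle μ (coeffPow (m + 2)) (integrable_coeffPow μ hk)]
  have h : ∀ z ∈ ball (0 : ℂ) 1,
      dens z • ∫ u, coeffPow (m + 2) (sec z * rot u) ∂haarCircle = (1 - ‖z‖ ^ 2) ^ m := by
    intro z hz
    have hin : ∀ u : Circle, coeffPow (m + 2) (sec z * rot u) = (1 - ‖z‖ ^ 2) ^ (m + 2) :=
      fun u => coeffPow_fib _ hz u
    simp_rw [hin]
    rw [integral_const, measureReal_def, haarCircle_univ, ENNReal.toReal_one, one_smul, smul_eq_mul,
      dens_mul_pow hz]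
  rw [setIntegral_congr_fun measurableSet_ball h, integral_ball_one_sub_norm_sq_pow]
  push_cast
  ring_nf

/-- **`∫_G (1 - |g·0|²)^k dν = π / (k - 1)`** for `k ≥ 2` (the disc computation, `c = 1`). -/
theorem integral_coeffPow_nu {k : ℕ} (hk : 2 ≤ k) :
    ∫ g, coeffPow k g ∂(nu haarCircle) = π / ((k : ℝ) - 1) := by
  have h := integral_coeffPow (nu haarCircle) hk
  rwa [haarScalarFactor_self, NNReal.coe_one, one_smul] at h

/-- **The Cartan computation, step 1**: `∫_G coeffPow k dν = 2π ∫_0^∞ sinh t · cosh^{-(2k-1)} t dt`. -/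
theorem integral_coeffPow_nu_cartan {k : ℕ} (hk : 2 ≤ k) :
    ∫ g, coeffPow k g ∂(nu haarCircle) =
      (2 * π) • ∫ t in Ioi (0 : ℝ), Real.sinh t * (Real.cosh t)⁻¹ ^ (2 * (k - 1) + 1) := by
  rw [integral_nu_biRotInvariant (integrable_coeffPow _ hk) (coeffPow_rot_mul_rot k)]
  congr 1
  refine setIntegral_congr_fun measurableSet_Ioi fun t _ => ?_
  rw [coeffPow_hyp, smul_eq_mul]
  have hc : Real.cosh t ≠ 0 := (Real.cosh_pos t).ne'
  obtain ⟨m, rfl⟩ := Nat.exists_eq_add_of_le' hk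
  rw [show m + 2 - 1 = m + 1 by omega, inv_pow, inv_pow]
  field_simp
  ring

/-- **The Cartan computation, step 2**: `∫_G (1 - |g·0|²)^k dν = π / (k - 1)` through the spherical
formula and `∫_0^∞ sinh t · cosh^{-(2k-1)} t dt = 1/(2(k-1))`. -/
theorem integral_coeffPow_nu_cartan' {k : ℕ} (hk : 2 ≤ k) :
    ∫ g, coeffPow k g ∂(nu haarCircle) = π / ((k : ℝ) - 1) := by
  rw [integral_coeffPow_nu_cartan hk, integral_sinh_mul_inv_cosh_pow (k - 1) (by omega), smul_eq_mul]
  obtain ⟨m, rfl⟩ := Nat.exists_eq_add_of_le' hk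
  rw [show m + 2 - 1 = m + 1 by omega]
  push_cast
  have hm : ((m : ℝ) + 1) ≠ 0 := by positivity
  have hm' : (1 + (m : ℝ)) ≠ 0 := by positivity
  have hm'' : ((m : ℝ) + 2 - 1) ≠ 0 := by
    rw [show (m : ℝ) + 2 - 1 = (m : ℝ) + 1 by ring]; exact hm
  rw [show (m : ℝ) + 2 - 1 = (m : ℝ) + 1 by ring]
  field_simp

/-- **The two computations agree for every weight**: the Cartan value of `∫_G coeffPow k dν` equals
the disc value `π / (k - 1)`. -/
theorem cartan_eq_disc_pow {k : ℕ} (hk : 2 ≤ k) :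
    (2 * π) • ∫ t in Ioi (0 : ℝ), Real.sinh t * (Real.cosh t)⁻¹ ^ (2 * (k - 1) + 1) =
      π / ((k : ℝ) - 1) := by
  rw [← integral_coeffPow_nu_cartan hk, integral_coeffPow_nu hk]

end measure

end Summit.Ventures.HodgeRepro2.T5SU11CoeffPowCartan
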